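import Literature.NumberTheory.Automorphic.UnitaryGroupTruncatedTraceClassElliptic
import Literature.NumberTheory.Automorphic.UnitaryGroupStableOrbitalIntegral
import Literature.NumberTheory.Rogawski1990.StableClassRegrouping
import Literature.NumberTheory.Automorphic.UnitaryGroupQuasiSplitWeilMeasure
import HarnessLib

/-!
# T1-qs LAW 4 in KIT CURRENCY: the elliptic class term `J^T_𝔬(f)` of the quasi-split `U(J₃)` over the RATIONAL conjugacy classes,
# with class-indexed orbital integrals `classOrbitalIntegralAlong toAdelic m f c` (Rogawski 1990, §2.2 p. 13, §5.4 p. 71; Arthur 1978 §8)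

Topic `NumberTheory/Automorphic`; namespace `Literature.NumberTheory.Automorphic.UnitaryGroup`; **THEOREMS ONLY** (no definition, no named fact, no
instance, no notation, no `sorry`).  Cell `pub/hodgecm-mathlib`, ENGINE T1 (crux H413 = `stmt-HodgeConjecture-24833`), (L4-g) «KIT-CURRENCY COROLLARY» of
the LAW 4 trunk (F0P3a-p05 (g5) 10:27:42Z; RULING #114 (1)): ★ (L4-d) `truncatedTraceClass_eq_mul_tsum_covol_mul_orbitalIntegral_cm`
(`UnitaryGroupTruncatedTraceClassElliptic`) indexes the elliptic class term by the conjugacy classes of the ARITHMETIC SUBGROUP `G(L⁺)·1 ⊂ G(𝔸)` with a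
section `rep`; the stabilisation kit (★ `UnitaryGroupStableOrbitalIntegral` §1, ★ (c1), pins (xii″)(xii-f) of `F0_T1InnerFormTraceIdentity`) indexes
orbital integrals by `ConjClasses G(L⁺)` along `toAdelic`, `classOrbitalIntegralAlong toAdelic m f c = O_{γ_c·1}^{m_c}(f)`, `γ_c = out c`.  This file
is the one-step translation: `G(L⁺) ≃* G(L⁺)·1` (★ `cmDatum_toAdelic_injective`; ★ `quasiSplit_eq_cmDatum` is `rfl`), the induced bijection of
conjugacy classes (★ `Rogawski1990.bijective_conjClassesMap_of_mulEquiv`), the section `rep s := (out (e⁻¹ s))·1` fed to (L4-d), and `Equiv.tsum_eq` —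
no dependent rewriting (the family `m` is TOTAL on the rational classes and tied to the Weil quotients `ν ∕ ν_c` on the elliptic classes by the
hypothesis `hm`, so a kit-side `AdelicOrbitalMeasureFamily`-shaped datum plugs in directly).

* **`truncatedTraceClass_eq_mul_tsum_covol_mul_classOrbitalIntegralAlong_cm`** — for the CM pair, `cl` conjugation-invariant, `i` an ELLIPTIC index
  (`cl β ≠ i` on `B(L⁺)`), Haar measures `ν_c` on the centralisers of the rational representatives `γ_c·1` of the classes in `𝔬`, and any total
  family `m` with `m_c = ν ∕ ν_c` there:
  `J^T_𝔬(f) = c_μ · Σ'_{c : cl (γ_c·1) = i} covol(G_{γ_c}(L⁺)·1 ∖ G_{γ_c}(𝔸); ν_c) · classOrbitalIntegralAlong toAdelic m f c`.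

## References
* [Rogawski1990] J. D. Rogawski, *Automorphic Representations of Unitary Groups in Three Variables*, Ann. of Math. Stud. 123 (1990), §2.2–§2.3 pp. 13–14, §5.4 p. 71.
* [Arthur1978TraceFormulaI] J. Arthur, *A trace formula for reductive groups I*, Duke Math. J. 45 (1978), §8.
* [Gelbart1975] S. Gelbart, *Automorphic forms on adele groups*, Ann. of Math. Stud. 83 (1975), (9.13), Thm. 9.22 (ii).
-/

set_option autoImplicit false

noncomputable section

open MeasureTheory Measure NumberField IsDedekindDomain Set Topology
open Literature.MeasureTheory.Group
open scoped NNReal ENNReal Pointwise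

namespace Literature.NumberTheory.Automorphic

namespace UnitaryGroup

/-- `[out c] = c` for conjugacy classes. [folklore] -/
private theorem conjClasses_mk_out₃ {A : Type*} [Monoid A] (c : ConjClasses A) : ConjClasses.mk (Quotient.out c) = c := by
  rw [← ConjClasses.quotient_mk_eq_mk, Quotient.out_eq]

/-- Re-indexing a `tsum` over a subtype along an equivalence of the ambient index types, summand by summand. [folklore] -/
private theorem tsum_subtype_reindex {α β : Type*} (e : α ≃ β) (P : β → Prop) (G : {a // P (e a)} → ℂ)
    (F : {b // P b} → ℂ) (h : ∀ a, G a = F ⟨e a.1, a.2⟩) : ∑' a, G a = ∑' b, F b := by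
  rw [← (Equiv.subtypeEquiv e fun _ => Iff.rfl).tsum_eq F]
  exact tsum_congr fun a => h a

/-- `classOrbitalIntegralAlong ι m f c` read at a propositionally equal orbit measure `m c = μ'`. [cite: Rogawski1990, §5.4 p. 71] -/
private theorem classOrbitalIntegralAlong_eq_of_eq {Γ G : Type*} [Group Γ] [Group G] (ι : Γ →* G)
    [∀ g : G, MeasurableSpace (G ⧸ Subgroup.centralizer ({g} : Set G))]
    (m : OrbitalMeasureFamilyAlong ι) (f : G → ℂ) (c : ConjClasses Γ)
    {μ' : Measure (G ⧸ Subgroup.centralizer ({ι (Quotient.out c)} : Set G))} (h : m c = μ') :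
    classOrbitalIntegralAlong ι m f c = orbitalIntegral (ι (Quotient.out c)) f μ' := by
  subst h
  exact classOrbitalIntegralAlong_eq ι m f c

/-- **LAW 4 IN KIT CURRENCY — `J^T_𝔬(f) = c_μ · Σ'_{[γ] ⊂ 𝔬} covol[γ] · Φ_𝔸([γ]; m; f)` over the RATIONAL classes.**  The T1-qs LAW 4
trunk closer ★ `truncatedTraceClass_eq_mul_tsum_covol_mul_orbitalIntegral_cm` (sum over the classes of the ARITHMETIC subgroup
`G(L⁺)·1 ⊂ G(𝔸)` in an elliptic `𝔬`, any section `rep`) re-indexed by `ConjClasses (quasiSplit L⁺ L c 3).Rational` along the diagonal embedding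
`toAdelic : G(L⁺) ≃* G(L⁺)·1` (★ `cmDatum_toAdelic_injective` through the `rfl` bridge ★ `quasiSplit_eq_cmDatum`; bijection of classes ★
`bijective_conjClassesMap_of_mulEquiv`) and written with the kit's class-indexed orbital integrals ★ `classOrbitalIntegralAlong (quasiSplit …).toAdelic m f c`
(`UnitaryGroupStableOrbitalIntegral` §1) for ANY total family `m : ∀ c, Measure (G(𝔸) ⧸ C(γ_c·1))` (= `OrbitalMeasureFamilyAlong toAdelic`) which on
the elliptic classes of `𝔬 = cl⁻¹ i` IS the Weil quotient `ν ∕ ν_c` (hypothesis `hm`; `ν_c` Haar on the centraliser, two-sided there by ★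
`isMulRightInvariant_centralizer_of_forall_cl_ne`) — the shape in which the kit's `SJ_G` letters (pins (xii″)(xii-f)) and ★ (c1)
`exists_covolWeight_diagTrace_eq_finsum_orbitalSum` read the geometric side (RULING #111 (2)). [cite: Rogawski1990, §2.2 (p. 13); §5.4 p. 71]
[cite: Arthur1978TraceFormulaI, §8] [cite: Gelbart1975, (9.13) and Thm. 9.22 (ii)] -/
theorem truncatedTraceClass_eq_mul_tsum_covol_mul_classOrbitalIntegralAlong_cm (L : Type) [Field L] [NumberField L] [IsCMField L]
    [MeasurableSpace (quasiSplit (↥(maximalRealSubfield L)) L (IsCMField.complexConj L) 3).Adelic]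
    [BorelSpace (quasiSplit (↥(maximalRealSubfield L)) L (IsCMField.complexConj L) 3).Adelic]
    [MeasurableSpace (adelicUnipotent (↥(maximalRealSubfield L)) L (IsCMField.complexConj L) 3)]
    [∀ γ : (quasiSplit (↥(maximalRealSubfield L)) L (IsCMField.complexConj L) 3).Adelic,
      MeasurableSpace ((quasiSplit (↥(maximalRealSubfield L)) L (IsCMField.complexConj L) 3).Adelic ⧸
        Subgroup.centralizer ({γ} : Set (quasiSplit (↥(maximalRealSubfield L)) L (IsCMField.complexConj L) 3).Adelic))]
    [∀ γ : (quasiSplit (↥(maximalRealSubfield L)) L (IsCMField.complexConj L) 3).Adelic,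
      BorelSpace ((quasiSplit (↥(maximalRealSubfield L)) L (IsCMField.complexConj L) 3).Adelic ⧸
        Subgroup.centralizer ({γ} : Set (quasiSplit (↥(maximalRealSubfield L)) L (IsCMField.complexConj L) 3).Adelic))]
    [∀ γ : (quasiSplit (↥(maximalRealSubfield L)) L (IsCMField.complexConj L) 3).Adelic,
      MeasurableSpace (↥(Subgroup.centralizer ({γ} : Set (quasiSplit (↥(maximalRealSubfield L)) L (IsCMField.complexConj L) 3).Adelic)) ⧸
        ((quasiSplit (↥(maximalRealSubfield L)) L (IsCMField.complexConj L) 3).quotientSubgroup ⊓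
          Subgroup.centralizer ({γ} : Set (quasiSplit (↥(maximalRealSubfield L)) L (IsCMField.complexConj L) 3).Adelic)).subgroupOf
          (Subgroup.centralizer ({γ} : Set (quasiSplit (↥(maximalRealSubfield L)) L (IsCMField.complexConj L) 3).Adelic)))]
    [∀ γ : (quasiSplit (↥(maximalRealSubfield L)) L (IsCMField.complexConj L) 3).Adelic,
      BorelSpace (↥(Subgroup.centralizer ({γ} : Set (quasiSplit (↥(maximalRealSubfield L)) L (IsCMField.complexConj L) 3).Adelic)) ⧸
        ((quasiSplit (↥(maximalRealSubfield L)) L (IsCMField.complexConj L) 3).quotientSubgroup ⊓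
          Subgroup.centralizer ({γ} : Set (quasiSplit (↥(maximalRealSubfield L)) L (IsCMField.complexConj L) 3).Adelic)).subgroupOf
          (Subgroup.centralizer ({γ} : Set (quasiSplit (↥(maximalRealSubfield L)) L (IsCMField.complexConj L) 3).Adelic)))]
    (μ : Measure (quasiSplit (↥(maximalRealSubfield L)) L (IsCMField.complexConj L) 3).automorphicQuotient)
    [(quasiSplit (↥(maximalRealSubfield L)) L (IsCMField.complexConj L) 3).IsAutomorphicMeasure μ]
    (ν : Measure (quasiSplit (↥(maximalRealSubfield L)) L (IsCMField.complexConj L) 3).Adelic) [IsHaarMeasure ν]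
    {ι : Type*} {cl : (quasiSplit (↥(maximalRealSubfield L)) L (IsCMField.complexConj L) 3).arithmeticSubgroup → ι}
    (hcl : IsConjInvariant cl) (i : ι)
    (νC : ∀ c : {c : ConjClasses (quasiSplit (↥(maximalRealSubfield L)) L (IsCMField.complexConj L) 3).Rational // cl ⟨(quasiSplit (↥(maximalRealSubfield L)) L (IsCMField.complexConj L) 3).toAdelic (Quotient.out c), Quotient.out c, rfl⟩ = i},
      Measure ↥(Subgroup.centralizer ({(quasiSplit (↥(maximalRealSubfield L)) L (IsCMField.complexConj L) 3).toAdelic (Quotient.out c.1)} : Set (quasiSplit (↥(maximalRealSubfield L)) L (IsCMField.complexConj L) 3).Adelic)))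
    [∀ c, IsHaarMeasure (νC c)]
    (m : ∀ c : ConjClasses (quasiSplit (↥(maximalRealSubfield L)) L (IsCMField.complexConj L) 3).Rational,
      Measure ((quasiSplit (↥(maximalRealSubfield L)) L (IsCMField.complexConj L) 3).Adelic ⧸ Subgroup.centralizer ({(quasiSplit (↥(maximalRealSubfield L)) L (IsCMField.complexConj L) 3).toAdelic (Quotient.out c)} : Set (quasiSplit (↥(maximalRealSubfield L)) L (IsCMField.complexConj L) 3).Adelic)))
    (hi : ∀ β : arithmeticBorel (↥(maximalRealSubfield L)) L (IsCMField.complexConj L) 3, cl β ≠ i)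
    {f : (quasiSplit (↥(maximalRealSubfield L)) L (IsCMField.complexConj L) 3).Adelic → ℂ}
    (hf : IsQuasiSplitTest (↥(maximalRealSubfield L)) L (IsCMField.complexConj L) 3 f)
    (ν₀ : Measure (adelicUnipotent (↥(maximalRealSubfield L)) L (IsCMField.complexConj L) 3))
    (𝓕 : Set (adelicUnipotent (↥(maximalRealSubfield L)) L (IsCMField.complexConj L) 3)) (T : ℝ≥0) :
    haveI := t2Space_quasiSplitAdelic (F := ↥(maximalRealSubfield L)) (E := L) (c := IsCMField.complexConj L) (N := 3)
    haveI := locallyCompactSpace_quasiSplitAdelic (F := ↥(maximalRealSubfield L)) (E := L) (c := IsCMField.complexConj L) (N := 3)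
    haveI := secondCountableTopology_quasiSplitAdelic (F := ↥(maximalRealSubfield L)) (E := L) (c := IsCMField.complexConj L) (N := 3)
    haveI : IsClosed (((quasiSplit (↥(maximalRealSubfield L)) L (IsCMField.complexConj L) 3).quotientSubgroup : Set (quasiSplit (↥(maximalRealSubfield L)) L (IsCMField.complexConj L) 3).Adelic)) :=
      isClosed_quotientSubgroup_quasiSplit
    haveI : ∀ γ : (quasiSplit (↥(maximalRealSubfield L)) L (IsCMField.complexConj L) 3).Adelic, IsClosed ((Subgroup.centralizer ({γ} : Set (quasiSplit (↥(maximalRealSubfield L)) L (IsCMField.complexConj L) 3).Adelic) :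
        Subgroup (quasiSplit (↥(maximalRealSubfield L)) L (IsCMField.complexConj L) 3).Adelic) : Set (quasiSplit (↥(maximalRealSubfield L)) L (IsCMField.complexConj L) 3).Adelic) := isClosed_centralizer_quasiSplit
    haveI : ∀ γ : (quasiSplit (↥(maximalRealSubfield L)) L (IsCMField.complexConj L) 3).Adelic, (count : Measure ↥(((quasiSplit (↥(maximalRealSubfield L)) L (IsCMField.complexConj L) 3).quotientSubgroup ⊓
        Subgroup.centralizer ({γ} : Set (quasiSplit (↥(maximalRealSubfield L)) L (IsCMField.complexConj L) 3).Adelic)).subgroupOf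
          (Subgroup.centralizer ({γ} : Set (quasiSplit (↥(maximalRealSubfield L)) L (IsCMField.complexConj L) 3).Adelic)))).IsHaarMeasure :=
      isHaarMeasure_count_inf_centralizer_subgroupOf_quasiSplit
    haveI : (count : Measure (quasiSplit (↥(maximalRealSubfield L)) L (IsCMField.complexConj L) 3).quotientSubgroup).IsHaarMeasure :=
      isHaarMeasure_count_quotientSubgroup_quasiSplit
    haveI : ν.IsMulRightInvariant := isMulRightInvariant_quasiSplit_cm_three L ν
    haveI : ∀ c : {c : ConjClasses (quasiSplit (↥(maximalRealSubfield L)) L (IsCMField.complexConj L) 3).Rational // cl ⟨(quasiSplit (↥(maximalRealSubfield L)) L (IsCMField.complexConj L) 3).toAdelic (Quotient.out c), Quotient.out c, rfl⟩ = i},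
        (νC c).IsMulRightInvariant := fun c =>
      isMulRightInvariant_centralizer_of_forall_cl_ne (complexConj_mul_complexConj L) hcl hi c.2 (νC c)
    haveI : ∀ c : {c : ConjClasses (quasiSplit (↥(maximalRealSubfield L)) L (IsCMField.complexConj L) 3).Rational // cl ⟨(quasiSplit (↥(maximalRealSubfield L)) L (IsCMField.complexConj L) 3).toAdelic (Quotient.out c), Quotient.out c, rfl⟩ = i},
        (νC c).IsInvInvariant := fun c =>
      isInvInvariant_centralizer_of_forall_cl_ne (complexConj_mul_complexConj L) hcl hi c.2 (νC c)
    letI := AdelicGroupData.measurableSpaceQuotientForm (quasiSplit (↥(maximalRealSubfield L)) L (IsCMField.complexConj L) 3)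
    haveI := AdelicGroupData.borelSpaceQuotientForm (quasiSplit (↥(maximalRealSubfield L)) L (IsCMField.complexConj L) 3)
    haveI := AdelicGroupData.smulInvariantMeasureQuotientForm (quasiSplit (↥(maximalRealSubfield L)) L (IsCMField.complexConj L) 3) μ
    haveI := AdelicGroupData.isFiniteMeasureOnCompactsQuotientForm (quasiSplit (↥(maximalRealSubfield L)) L (IsCMField.complexConj L) 3) μ
    (∀ c : {c : ConjClasses (quasiSplit (↥(maximalRealSubfield L)) L (IsCMField.complexConj L) 3).Rational // cl ⟨(quasiSplit (↥(maximalRealSubfield L)) L (IsCMField.complexConj L) 3).toAdelic (Quotient.out c), Quotient.out c, rfl⟩ = i},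
        m c.1 = quotientMeasure (Subgroup.centralizer ({(quasiSplit (↥(maximalRealSubfield L)) L (IsCMField.complexConj L) 3).toAdelic (Quotient.out c.1)} : Set (quasiSplit (↥(maximalRealSubfield L)) L (IsCMField.complexConj L) 3).Adelic)) (νC c)
          (isClosed_centralizer_quasiSplit _) ν) →
    truncatedTraceClass μ ν₀ 𝓕 T cl i f =
      ((unfoldingConstant (quasiSplit (↥(maximalRealSubfield L)) L (IsCMField.complexConj L) 3).quotientSubgroup
          (count : Measure (quasiSplit (↥(maximalRealSubfield L)) L (IsCMField.complexConj L) 3).quotientSubgroup) μ ν : ℝ) : ℂ) *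
        ∑' c : {c : ConjClasses (quasiSplit (↥(maximalRealSubfield L)) L (IsCMField.complexConj L) 3).Rational // cl ⟨(quasiSplit (↥(maximalRealSubfield L)) L (IsCMField.complexConj L) 3).toAdelic (Quotient.out c), Quotient.out c, rfl⟩ = i},
          ((quotientMeasure (((quasiSplit (↥(maximalRealSubfield L)) L (IsCMField.complexConj L) 3).quotientSubgroup ⊓
              Subgroup.centralizer ({(quasiSplit (↥(maximalRealSubfield L)) L (IsCMField.complexConj L) 3).toAdelic (Quotient.out c.1)} : Set (quasiSplit (↥(maximalRealSubfield L)) L (IsCMField.complexConj L) 3).Adelic)).subgroupOf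
              (Subgroup.centralizer ({(quasiSplit (↥(maximalRealSubfield L)) L (IsCMField.complexConj L) 3).toAdelic (Quotient.out c.1)} : Set (quasiSplit (↥(maximalRealSubfield L)) L (IsCMField.complexConj L) 3).Adelic)))
              count (isClosed_inf_centralizer_subgroupOf_quasiSplit _) (νC c) Set.univ).toReal : ℂ) *
            classOrbitalIntegralAlong (quasiSplit (↥(maximalRealSubfield L)) L (IsCMField.complexConj L) 3).toAdelic m f c.1 := by
  intro hm
  classical
  -- injectivity of the diagonal embedding, stated ONCE in `quasiSplit` letters (★ `quasiSplit_eq_cmDatum` is `rfl`): every later term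
  -- stays in `quasiSplit` letters, so no summand ever re-checks `quasiSplit … = cmDatum …`
  have hinj : Function.Injective (quasiSplit (↥(maximalRealSubfield L)) L (IsCMField.complexConj L) 3).toAdelic :=
    cmDatum_toAdelic_injective L 3 ((StdForm.antidiagonal 3).over L)
  -- the diagonal embedding as an isomorphism onto the arithmetic subgroup, and the induced bijection of classes
  let ιE : (quasiSplit (↥(maximalRealSubfield L)) L (IsCMField.complexConj L) 3).Rational ≃* (quasiSplit (↥(maximalRealSubfield L)) L (IsCMField.complexConj L) 3).arithmeticSubgroup := MonoidHom.ofInjective hinj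
  let e : ConjClasses (quasiSplit (↥(maximalRealSubfield L)) L (IsCMField.complexConj L) 3).Rational ≃ ConjClasses (quasiSplit (↥(maximalRealSubfield L)) L (IsCMField.complexConj L) 3).arithmeticSubgroup :=
    Equiv.ofBijective _ (Literature.NumberTheory.Rogawski1990.bijective_conjClassesMap_of_mulEquiv ιE)
  have he_mk : ∀ γ : (quasiSplit (↥(maximalRealSubfield L)) L (IsCMField.complexConj L) 3).Rational, e (ConjClasses.mk γ) = ConjClasses.mk (ιE γ) := fun γ => rfl
  -- the section of representatives `rep s := (out (e⁻¹ s))·1`, as an explicit element of the arithmetic subgroup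
  let rep : ConjClasses (quasiSplit (↥(maximalRealSubfield L)) L (IsCMField.complexConj L) 3).arithmeticSubgroup → (quasiSplit (↥(maximalRealSubfield L)) L (IsCMField.complexConj L) 3).arithmeticSubgroup :=
    fun s => ⟨(quasiSplit (↥(maximalRealSubfield L)) L (IsCMField.complexConj L) 3).toAdelic (Quotient.out (e.symm s)), Quotient.out (e.symm s), rfl⟩
  have hrep : ∀ s, ConjClasses.mk (rep s) = s := fun s => by
    have h1 : rep s = ιE (Quotient.out (e.symm s)) := Subtype.ext (MonoidHom.ofInjective_apply hinj).symm
    rw [h1, ← he_mk, conjClasses_mk_out₃, Equiv.apply_symm_apply]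
  -- ★ (L4-d) at this section, with the centraliser measures read through `e.symm`
  let νC' : ∀ s : {s : ConjClasses (quasiSplit (↥(maximalRealSubfield L)) L (IsCMField.complexConj L) 3).arithmeticSubgroup // cl (rep s) = i},
      Measure ↥(Subgroup.centralizer ({((rep s.1 : (quasiSplit (↥(maximalRealSubfield L)) L (IsCMField.complexConj L) 3).arithmeticSubgroup) : (quasiSplit (↥(maximalRealSubfield L)) L (IsCMField.complexConj L) 3).Adelic)} : Set (quasiSplit (↥(maximalRealSubfield L)) L (IsCMField.complexConj L) 3).Adelic)) :=
    fun s => νC ⟨e.symm s.1, s.2⟩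
  haveI hνC' : ∀ s, (νC' s).IsHaarMeasure := fun s => (inferInstance : (νC ⟨e.symm s.1, s.2⟩).IsHaarMeasure)
  have key := truncatedTraceClass_eq_mul_tsum_covol_mul_orbitalIntegral_cm L μ ν hcl i rep hrep νC' hi hf ν₀ 𝓕 T
  -- re-index the sum along `s ↦ e.symm s`; summand by summand the two sides agree up to `hm` (no dependent rewriting)
  refine key.trans (congrArg₂ (· * ·) rfl (tsum_subtype_reindex e.symm
    (fun c => cl ⟨(quasiSplit (↥(maximalRealSubfield L)) L (IsCMField.complexConj L) 3).toAdelic (Quotient.out c), Quotient.out c, rfl⟩ = i) _ _ fun s => ?_))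
  exact congrArg₂ (· * ·) rfl
    (classOrbitalIntegralAlong_eq_of_eq (quasiSplit (↥(maximalRealSubfield L)) L (IsCMField.complexConj L) 3).toAdelic m f _ (hm ⟨e.symm s.1, s.2⟩)).symm

/-! ## §2 The same AT THE WEIL MEASURE `μ = ν ∕ count`: no constant (★ B-p04 (g27) `UnitaryGroupQuasiSplitWeilMeasure`: `c_{ν∕count} = 1`) -/

/-- **LAW 4 IN KIT CURRENCY AT THE WEIL MEASURE — `J^T_𝔬(f) = Σ'_{[γ] ⊂ 𝔬} covol[γ] · Φ_𝔸([γ]; m; f)`, NO constant.**  ★ §1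
`truncatedTraceClass_eq_mul_tsum_covol_mul_classOrbitalIntegralAlong_cm` for the automorphic measure `μ = ν ∕ count` (equation binder `hμ`; the
instance `IsAutomorphicMeasure μ` is the caller's, e.g. ★ `isAutomorphicMeasure_quotientMeasure_count_quasiSplit_three`), where Weil's constant is `1`
(★ `AdelicGroupData.ofReal_coe_unfoldingConstant_quotientMeasure_eq_one`): the sum runs over the RATIONAL conjugacy classes `c` of `G(L⁺) = (quasiSplit L⁺ L c 3).Rational`
in the elliptic class `𝔬 = cl⁻¹ i`, the weights ARE the covolumes `vol(G_{γ_c}(L⁺)·1 ∖ G_{γ_c}(𝔸); ν_c)` and the orbital integrals are the kit's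
`classOrbitalIntegralAlong toAdelic m f c` for ANY total family `m` agreeing with the Weil quotients `ν ∕ ν_c` on `𝔬` (hypothesis `hm`) — the ONE name the
(xii″)(xii-f) socket assembler cites (F0P3a-plan (g5) 11:04:55Z), parallel to ★ B-p04 (g27) `truncatedTraceClass_eq_tsum_covol_mul_orbitalIntegral_of_eq_quotientMeasure_cm`
on the arithmetic-subgroup side. [cite: Rogawski1990, §2.2 (p. 13); §5.4 p. 71] [cite: Arthur1978TraceFormulaI, §8] [cite: Gelbart1975, (9.13) and Remark 9.23] -/
theorem truncatedTraceClass_eq_tsum_covol_mul_classOrbitalIntegralAlong_of_eq_quotientMeasure_cm (L : Type) [Field L] [NumberField L] [IsCMField L]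
    [MeasurableSpace (quasiSplit (↥(maximalRealSubfield L)) L (IsCMField.complexConj L) 3).Adelic]
    [BorelSpace (quasiSplit (↥(maximalRealSubfield L)) L (IsCMField.complexConj L) 3).Adelic]
    [MeasurableSpace (adelicUnipotent (↥(maximalRealSubfield L)) L (IsCMField.complexConj L) 3)]
    [∀ γ : (quasiSplit (↥(maximalRealSubfield L)) L (IsCMField.complexConj L) 3).Adelic,
      MeasurableSpace ((quasiSplit (↥(maximalRealSubfield L)) L (IsCMField.complexConj L) 3).Adelic ⧸
        Subgroup.centralizer ({γ} : Set (quasiSplit (↥(maximalRealSubfield L)) L (IsCMField.complexConj L) 3).Adelic))]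
    [∀ γ : (quasiSplit (↥(maximalRealSubfield L)) L (IsCMField.complexConj L) 3).Adelic,
      BorelSpace ((quasiSplit (↥(maximalRealSubfield L)) L (IsCMField.complexConj L) 3).Adelic ⧸
        Subgroup.centralizer ({γ} : Set (quasiSplit (↥(maximalRealSubfield L)) L (IsCMField.complexConj L) 3).Adelic))]
    [∀ γ : (quasiSplit (↥(maximalRealSubfield L)) L (IsCMField.complexConj L) 3).Adelic,
      MeasurableSpace (↥(Subgroup.centralizer ({γ} : Set (quasiSplit (↥(maximalRealSubfield L)) L (IsCMField.complexConj L) 3).Adelic)) ⧸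
        ((quasiSplit (↥(maximalRealSubfield L)) L (IsCMField.complexConj L) 3).quotientSubgroup ⊓
          Subgroup.centralizer ({γ} : Set (quasiSplit (↥(maximalRealSubfield L)) L (IsCMField.complexConj L) 3).Adelic)).subgroupOf
          (Subgroup.centralizer ({γ} : Set (quasiSplit (↥(maximalRealSubfield L)) L (IsCMField.complexConj L) 3).Adelic)))]
    [∀ γ : (quasiSplit (↥(maximalRealSubfield L)) L (IsCMField.complexConj L) 3).Adelic,
      BorelSpace (↥(Subgroup.centralizer ({γ} : Set (quasiSplit (↥(maximalRealSubfield L)) L (IsCMField.complexConj L) 3).Adelic)) ⧸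
        ((quasiSplit (↥(maximalRealSubfield L)) L (IsCMField.complexConj L) 3).quotientSubgroup ⊓
          Subgroup.centralizer ({γ} : Set (quasiSplit (↥(maximalRealSubfield L)) L (IsCMField.complexConj L) 3).Adelic)).subgroupOf
          (Subgroup.centralizer ({γ} : Set (quasiSplit (↥(maximalRealSubfield L)) L (IsCMField.complexConj L) 3).Adelic)))]
    (μ : Measure (quasiSplit (↥(maximalRealSubfield L)) L (IsCMField.complexConj L) 3).automorphicQuotient)
    [(quasiSplit (↥(maximalRealSubfield L)) L (IsCMField.complexConj L) 3).IsAutomorphicMeasure μ]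
    (ν : Measure (quasiSplit (↥(maximalRealSubfield L)) L (IsCMField.complexConj L) 3).Adelic) [IsHaarMeasure ν]
    {ι : Type*} {cl : (quasiSplit (↥(maximalRealSubfield L)) L (IsCMField.complexConj L) 3).arithmeticSubgroup → ι}
    (hcl : IsConjInvariant cl) (i : ι)
    (νC : ∀ c : {c : ConjClasses (quasiSplit (↥(maximalRealSubfield L)) L (IsCMField.complexConj L) 3).Rational // cl ⟨(quasiSplit (↥(maximalRealSubfield L)) L (IsCMField.complexConj L) 3).toAdelic (Quotient.out c), Quotient.out c, rfl⟩ = i},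
      Measure ↥(Subgroup.centralizer ({(quasiSplit (↥(maximalRealSubfield L)) L (IsCMField.complexConj L) 3).toAdelic (Quotient.out c.1)} : Set (quasiSplit (↥(maximalRealSubfield L)) L (IsCMField.complexConj L) 3).Adelic)))
    [∀ c, IsHaarMeasure (νC c)]
    (m : ∀ c : ConjClasses (quasiSplit (↥(maximalRealSubfield L)) L (IsCMField.complexConj L) 3).Rational,
      Measure ((quasiSplit (↥(maximalRealSubfield L)) L (IsCMField.complexConj L) 3).Adelic ⧸ Subgroup.centralizer ({(quasiSplit (↥(maximalRealSubfield L)) L (IsCMField.complexConj L) 3).toAdelic (Quotient.out c)} : Set (quasiSplit (↥(maximalRealSubfield L)) L (IsCMField.complexConj L) 3).Adelic)))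
    (hi : ∀ β : arithmeticBorel (↥(maximalRealSubfield L)) L (IsCMField.complexConj L) 3, cl β ≠ i)
    {f : (quasiSplit (↥(maximalRealSubfield L)) L (IsCMField.complexConj L) 3).Adelic → ℂ}
    (hf : IsQuasiSplitTest (↥(maximalRealSubfield L)) L (IsCMField.complexConj L) 3 f)
    (ν₀ : Measure (adelicUnipotent (↥(maximalRealSubfield L)) L (IsCMField.complexConj L) 3))
    (𝓕 : Set (adelicUnipotent (↥(maximalRealSubfield L)) L (IsCMField.complexConj L) 3)) (T : ℝ≥0) :
    haveI := t2Space_quasiSplitAdelic (F := ↥(maximalRealSubfield L)) (E := L) (c := IsCMField.complexConj L) (N := 3)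
    haveI := locallyCompactSpace_quasiSplitAdelic (F := ↥(maximalRealSubfield L)) (E := L) (c := IsCMField.complexConj L) (N := 3)
    haveI := secondCountableTopology_quasiSplitAdelic (F := ↥(maximalRealSubfield L)) (E := L) (c := IsCMField.complexConj L) (N := 3)
    haveI : IsClosed (((quasiSplit (↥(maximalRealSubfield L)) L (IsCMField.complexConj L) 3).quotientSubgroup : Set (quasiSplit (↥(maximalRealSubfield L)) L (IsCMField.complexConj L) 3).Adelic)) :=
      isClosed_quotientSubgroup_quasiSplit
    haveI : ∀ γ : (quasiSplit (↥(maximalRealSubfield L)) L (IsCMField.complexConj L) 3).Adelic, IsClosed ((Subgroup.centralizer ({γ} : Set (quasiSplit (↥(maximalRealSubfield L)) L (IsCMField.complexConj L) 3).Adelic) :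
        Subgroup (quasiSplit (↥(maximalRealSubfield L)) L (IsCMField.complexConj L) 3).Adelic) : Set (quasiSplit (↥(maximalRealSubfield L)) L (IsCMField.complexConj L) 3).Adelic) := isClosed_centralizer_quasiSplit
    haveI : ∀ γ : (quasiSplit (↥(maximalRealSubfield L)) L (IsCMField.complexConj L) 3).Adelic, (count : Measure ↥(((quasiSplit (↥(maximalRealSubfield L)) L (IsCMField.complexConj L) 3).quotientSubgroup ⊓
        Subgroup.centralizer ({γ} : Set (quasiSplit (↥(maximalRealSubfield L)) L (IsCMField.complexConj L) 3).Adelic)).subgroupOf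
          (Subgroup.centralizer ({γ} : Set (quasiSplit (↥(maximalRealSubfield L)) L (IsCMField.complexConj L) 3).Adelic)))).IsHaarMeasure :=
      isHaarMeasure_count_inf_centralizer_subgroupOf_quasiSplit
    haveI : (count : Measure (quasiSplit (↥(maximalRealSubfield L)) L (IsCMField.complexConj L) 3).quotientSubgroup).IsHaarMeasure :=
      isHaarMeasure_count_quotientSubgroup_quasiSplit
    haveI : ν.IsMulRightInvariant := isMulRightInvariant_quasiSplit_cm_three L ν
    haveI : ∀ c : {c : ConjClasses (quasiSplit (↥(maximalRealSubfield L)) L (IsCMField.complexConj L) 3).Rational // cl ⟨(quasiSplit (↥(maximalRealSubfield L)) L (IsCMField.complexConj L) 3).toAdelic (Quotient.out c), Quotient.out c, rfl⟩ = i},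
        (νC c).IsMulRightInvariant := fun c =>
      isMulRightInvariant_centralizer_of_forall_cl_ne (complexConj_mul_complexConj L) hcl hi c.2 (νC c)
    haveI : ∀ c : {c : ConjClasses (quasiSplit (↥(maximalRealSubfield L)) L (IsCMField.complexConj L) 3).Rational // cl ⟨(quasiSplit (↥(maximalRealSubfield L)) L (IsCMField.complexConj L) 3).toAdelic (Quotient.out c), Quotient.out c, rfl⟩ = i},
        (νC c).IsInvInvariant := fun c =>
      isInvInvariant_centralizer_of_forall_cl_ne (complexConj_mul_complexConj L) hcl hi c.2 (νC c)
    letI := AdelicGroupData.measurableSpaceQuotientForm (quasiSplit (↥(maximalRealSubfield L)) L (IsCMField.complexConj L) 3)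
    haveI := AdelicGroupData.borelSpaceQuotientForm (quasiSplit (↥(maximalRealSubfield L)) L (IsCMField.complexConj L) 3)
    haveI := AdelicGroupData.smulInvariantMeasureQuotientForm (quasiSplit (↥(maximalRealSubfield L)) L (IsCMField.complexConj L) 3) μ
    haveI := AdelicGroupData.isFiniteMeasureOnCompactsQuotientForm (quasiSplit (↥(maximalRealSubfield L)) L (IsCMField.complexConj L) 3) μ
    μ = quotientMeasure (quasiSplit (↥(maximalRealSubfield L)) L (IsCMField.complexConj L) 3).quotientSubgroup (count : Measure (quasiSplit (↥(maximalRealSubfield L)) L (IsCMField.complexConj L) 3).quotientSubgroup)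
          (isClosed_quotientSubgroup_quasiSplit (F := ↥(maximalRealSubfield L)) (E := L) (c := IsCMField.complexConj L)) ν →
    (∀ c : {c : ConjClasses (quasiSplit (↥(maximalRealSubfield L)) L (IsCMField.complexConj L) 3).Rational // cl ⟨(quasiSplit (↥(maximalRealSubfield L)) L (IsCMField.complexConj L) 3).toAdelic (Quotient.out c), Quotient.out c, rfl⟩ = i},
        m c.1 = quotientMeasure (Subgroup.centralizer ({(quasiSplit (↥(maximalRealSubfield L)) L (IsCMField.complexConj L) 3).toAdelic (Quotient.out c.1)} : Set (quasiSplit (↥(maximalRealSubfield L)) L (IsCMField.complexConj L) 3).Adelic)) (νC c)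
          (isClosed_centralizer_quasiSplit _) ν) →
    truncatedTraceClass μ ν₀ 𝓕 T cl i f =
        ∑' c : {c : ConjClasses (quasiSplit (↥(maximalRealSubfield L)) L (IsCMField.complexConj L) 3).Rational // cl ⟨(quasiSplit (↥(maximalRealSubfield L)) L (IsCMField.complexConj L) 3).toAdelic (Quotient.out c), Quotient.out c, rfl⟩ = i},
          ((quotientMeasure (((quasiSplit (↥(maximalRealSubfield L)) L (IsCMField.complexConj L) 3).quotientSubgroup ⊓
              Subgroup.centralizer ({(quasiSplit (↥(maximalRealSubfield L)) L (IsCMField.complexConj L) 3).toAdelic (Quotient.out c.1)} : Set (quasiSplit (↥(maximalRealSubfield L)) L (IsCMField.complexConj L) 3).Adelic)).subgroupOf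
              (Subgroup.centralizer ({(quasiSplit (↥(maximalRealSubfield L)) L (IsCMField.complexConj L) 3).toAdelic (Quotient.out c.1)} : Set (quasiSplit (↥(maximalRealSubfield L)) L (IsCMField.complexConj L) 3).Adelic)))
              count (isClosed_inf_centralizer_subgroupOf_quasiSplit _) (νC c) Set.univ).toReal : ℂ) *
            classOrbitalIntegralAlong (quasiSplit (↥(maximalRealSubfield L)) L (IsCMField.complexConj L) 3).toAdelic m f c.1 := by
  intro hμ hm
  have h := truncatedTraceClass_eq_mul_tsum_covol_mul_classOrbitalIntegralAlong_cm L μ ν hcl i νC m hi hf ν₀ 𝓕 T hm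
  subst hμ
  haveI := t2Space_quasiSplitAdelic (F := ↥(maximalRealSubfield L)) (E := L) (c := IsCMField.complexConj L) (N := 3)
  haveI := locallyCompactSpace_quasiSplitAdelic (F := ↥(maximalRealSubfield L)) (E := L) (c := IsCMField.complexConj L) (N := 3)
  haveI := secondCountableTopology_quasiSplitAdelic (F := ↥(maximalRealSubfield L)) (E := L) (c := IsCMField.complexConj L) (N := 3)
  haveI : (count : Measure (quasiSplit (↥(maximalRealSubfield L)) L (IsCMField.complexConj L) 3).quotientSubgroup).IsHaarMeasure :=
    isHaarMeasure_count_quotientSubgroup_quasiSplit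
  haveI : DiscreteTopology (quasiSplit (↥(maximalRealSubfield L)) L (IsCMField.complexConj L) 3).quotientSubgroup := discreteTopology_quotientSubgroup_quasiSplit
  haveI : ν.IsMulRightInvariant := isMulRightInvariant_quasiSplit_cm_three L ν
  have h1 := AdelicGroupData.ofReal_coe_unfoldingConstant_quotientMeasure_eq_one (quasiSplit (↥(maximalRealSubfield L)) L (IsCMField.complexConj L) 3)
    (isClosed_quotientSubgroup_quasiSplit (F := ↥(maximalRealSubfield L)) (E := L) (c := IsCMField.complexConj L)) count ν
  simp only [h1, one_mul] at h
  exact h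

end UnitaryGroup

end Literature.NumberTheory.Automorphic

end
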